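import Summits.Ventures.LatticeQCDFlow.Exactness.ReversiblePositiveThinning
import Summits.Ventures.LatticeQCDFlow.Exactness.Phi4FlowCrossObservableFloor
import HarnessLib

/-!
# The exact flow sampler decorrelates every bounded observable MONOTONICALLY, and its thinned `τ_int` is pinned

HONEST FRAMING: exact (Metropolis-corrected) sampling algorithms for lattice gauge theory;
figures of merit are autocorrelation/cost numbers at stated couplings and volumes; no
continuum-physics claim.  (SCALAR calibration rung S0-A: not a gauge result.)

Venture `LatticeQCDFlow` (cell pub-lqcd), topic `Exactness`; FANOUT row 2 (`s0-phi4`, FLOW arm: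
independence Metropolis `K = imhOp μ w q̃` with target weight `w = e^{−S}` and model density `q̃`;
lattice φ⁴ `imhOpPhi4 J λ q̃`).  NEW WORK of the cell: the flow-arm instances of
`Exactness/ReversiblePositive.lean` / `ReversiblePositiveThinning.lean`.  The hypothesis (pos) is the
tree's `integral_mul_imhOp_mul_nonneg` (`Exactness/FlowSamplerPositive.lean`, Liu 1996 NAMED there);
the contraction property is gen-17's `integral_imhOp_sq_le_integral_sq`.  The tree already had, for
the flow arm, `C(k) ≥ 0`, log-convexity, `ρ(k) ≥ ρ(1)ᵏ` and monotone windows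
(`FlowSamplerLogConvex` / `FlowSamplerTauIntFloor`); NEW here: the autocovariances DECREASE and are
CONVEX lag by lag, and the `V`-thinned `τ_int` is pinned by the unthinned one.  Nothing is cited as
a fact.

## What is proved (general `(X, μ)` s-finite, `w > 0` integrable, `q > 0` measurable integrable with
`∫ q = 1`, `g` measurable bounded; `C(k) = ∫ g (Kᵏ g) w`)

* **`imhOp_autocov_succ_le_and_convex`** — `C(k+1) ≤ C(k)` and `C(k+1) − C(k+2) ≤ C(k) − C(k+1)`
  for EVERY lag: the exact flow sampler never over-shoots into anti-correlation and loses
  correlation at a decreasing rate, for every bounded observable and every model `q̃`;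
* **`imhOp_thinned_pinned`** — `∫ g² w > 0`, summable series, `V ≥ 1`:
  `(τ + ½)/V − ½ ≤ τ^{(V)} ≤ ½ + (τ − ½)/V` (recording every `V`-th flow proposal);
* lattice φ⁴ (every `λ > 0`, real `J`, every positive measurable model density with `∫ q̃ = 1`):
  **`phi4Flow_autocov_succ_le_and_convex`**, **`phi4Flow_thinned_pinned`**.

NOT CLAIMED: unbounded observables (the magnetisation itself needs a first-moment class); any rate;
any number for a trained network.
-/

namespace Summit.Ventures.LatticeQCDFlow.Exactness

open Real MeasureTheory Filter Finset Topology
open Summit.Ventures.LatticeQCDFlow.Scoring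

section General

variable {X : Type*} [MeasurableSpace X] {μ : Measure X} [SFinite μ] {w q : X → ℝ}

/-- **THE FLOW SAMPLER DECORRELATES MONOTONICALLY AND CONVEXLY**: for bounded measurable `g` and
every lag `k`, `C(k+1) ≤ C(k)` and `C(k+1) − C(k+2) ≤ C(k) − C(k+1)`. -/
theorem imhOp_autocov_succ_le_and_convex (hw0 : ∀ t, 0 < w t) (hwm : Measurable w)
    (hwi : Integrable w μ) (hq0 : ∀ t, 0 < q t) (hqm : Measurable q) (hqi : Integrable q μ)
    (hq1 : ∫ t, q t ∂μ = 1) {g : X → ℝ} (hgm : Measurable g) {Bg : ℝ} (hgb : ∀ t, |g t| ≤ Bg)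
    (k : ℕ) :
    ∫ t, g t * ((imhOp μ w q)^[k + 1] g) t * w t ∂μ ≤ ∫ t, g t * ((imhOp μ w q)^[k] g) t * w t ∂μ ∧
    (∫ t, g t * ((imhOp μ w q)^[k + 1] g) t * w t ∂μ) - ∫ t, g t * ((imhOp μ w q)^[k + 2] g) t * w t ∂μ
      ≤ (∫ t, g t * ((imhOp μ w q)^[k] g) t * w t ∂μ)
        - ∫ t, g t * ((imhOp μ w q)^[k + 1] g) t * w t ∂μ := by
  have hAi : ∀ ⦃f h : X → ℝ⦄, (Measurable f ∧ ∃ B : ℝ, ∀ t, |f t| ≤ B) →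
      (Measurable h ∧ ∃ B : ℝ, ∀ t, |h t| ≤ B) → Integrable (fun x => f x * h x * w x) μ := by
    intro f h hf hh
    obtain ⟨hfm', Bf, hfb'⟩ := hf
    obtain ⟨hhm', Bh, hhb'⟩ := hh
    exact integrable_mul_mul_weight hw0 hwm hwi hfm' hhm' hfb' hhb'
  have hAc : ∀ ⦃f h : X → ℝ⦄ (l : ℝ), (Measurable f ∧ ∃ B : ℝ, ∀ t, |f t| ≤ B) →
      (Measurable h ∧ ∃ B : ℝ, ∀ t, |h t| ≤ B) →
      (Measurable (fun x => f x + l * h x) ∧ ∃ B : ℝ, ∀ t, |f t + l * h t| ≤ B) := by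
    intro f h l hf hh
    obtain ⟨hfm', Bf, hfb'⟩ := hf
    obtain ⟨hhm', Bh, hhb'⟩ := hh
    refine ⟨hfm'.add (measurable_const.mul hhm'), Bf + |l| * Bh, fun t => ?_⟩
    calc |f t + l * h t| ≤ |f t| + |l * h t| := abs_add_le _ _
      _ ≤ Bf + |l| * Bh := by
          rw [abs_mul]; exact add_le_add (hfb' t) (mul_le_mul_of_nonneg_left (hhb' t) (abs_nonneg _))
  have hAK : ∀ ⦃f : X → ℝ⦄, (Measurable f ∧ ∃ B : ℝ, ∀ t, |f t| ≤ B) →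
      (Measurable (imhOp μ w q f) ∧ ∃ B : ℝ, ∀ t, |imhOp μ w q f t| ≤ B) := by
    intro f hf
    obtain ⟨hfm', Bf, hfb'⟩ := hf
    exact ⟨measurable_imhOp hwm hqm hfm', Bf, imhOp_abs_le hw0 hq0 hqi hq1 hfb'⟩
  have hlin : ∀ ⦃f h : X → ℝ⦄ (l : ℝ), (Measurable f ∧ ∃ B : ℝ, ∀ t, |f t| ≤ B) →
      (Measurable h ∧ ∃ B : ℝ, ∀ t, |h t| ≤ B) →
      ∀ t, imhOp μ w q (fun s => f s + l * h s) t = imhOp μ w q f t + l * imhOp μ w q h t := by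
    intro f h l hf hh t
    obtain ⟨hfm', Bf, hfb'⟩ := hf
    obtain ⟨hhm', Bh, hhb'⟩ := hh
    exact imhOp_add_mul hw0 hwm hq0 hqm hqi hfm' hhm' hfb' hhb' l t
  have hsymm : ∀ ⦃f h : X → ℝ⦄, (Measurable f ∧ ∃ B : ℝ, ∀ t, |f t| ≤ B) →
      (Measurable h ∧ ∃ B : ℝ, ∀ t, |h t| ≤ B) →
      ∫ x, imhOp μ w q f x * h x * w x ∂μ = ∫ x, f x * imhOp μ w q h x * w x ∂μ := by
    intro f h hf hh
    obtain ⟨hfm', Bf, hfb'⟩ := hf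
    obtain ⟨hhm', Bh, hhb'⟩ := hh
    exact integral_imhOp_mul_mul_comm hw0 hwm hwi hq0 hqm hqi hfm' hhm' hfb' hhb'
  have hcontr : ∀ ⦃f : X → ℝ⦄, (Measurable f ∧ ∃ B : ℝ, ∀ t, |f t| ≤ B) →
      ∫ x, imhOp μ w q f x ^ 2 * w x ∂μ ≤ ∫ x, f x ^ 2 * w x ∂μ := by
    intro f hf
    obtain ⟨hfm', Bf, hfb'⟩ := hf
    exact integral_imhOp_sq_le_integral_sq hw0 hwm hwi hq0 hqm hqi hq1 hfm' hfb'
  have hpos : ∀ ⦃f : X → ℝ⦄, (Measurable f ∧ ∃ B : ℝ, ∀ t, |f t| ≤ B) →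
      0 ≤ ∫ x, f x * imhOp μ w q f x * w x ∂μ := by
    intro f hf
    obtain ⟨hfm', Bf, hfb'⟩ := hf
    exact integral_mul_imhOp_mul_nonneg hw0 hwm hwi hq0 hqm hqi hq1 hfm' hfb'
  exact ⟨RevOp.autocov_succ_le_of_pos (μ := μ)
      (A := fun f : X → ℝ => Measurable f ∧ ∃ B : ℝ, ∀ t, |f t| ≤ B) (K := imhOp μ w q) (w := w)
      (fun t => (hw0 t).le) hAi hAc hAK hlin hsymm hcontr hpos ⟨hgm, Bg, hgb⟩ k,
    RevOp.autocov_convex_of_pos (μ := μ)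
      (A := fun f : X → ℝ => Measurable f ∧ ∃ B : ℝ, ∀ t, |f t| ≤ B) (K := imhOp μ w q) (w := w)
      (fun t => (hw0 t).le) hAi hAc hAK hlin hsymm hpos ⟨hgm, Bg, hgb⟩ k⟩

/-- **THINNING IS PINNED FOR THE FLOW SAMPLER**: bounded measurable `g` with `∫ g² w > 0` and a
summable normalised series; observe every `V ≥ 1` proposals:
`(τ + ½)/V − ½ ≤ τ^{(V)} ≤ ½ + (τ − ½)/V`. -/
theorem imhOp_thinned_pinned (hw0 : ∀ t, 0 < w t) (hwm : Measurable w)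
    (hwi : Integrable w μ) (hq0 : ∀ t, 0 < q t) (hqm : Measurable q) (hqi : Integrable q μ)
    (hq1 : ∫ t, q t ∂μ = 1) {g : X → ℝ} (hgm : Measurable g) {Bg : ℝ} (hgb : ∀ t, |g t| ≤ Bg)
    (hP : 0 < ∫ t, g t ^ 2 * w t ∂μ) {V : ℕ} (hV : 1 ≤ V)
    (hs : Summable fun n => (∫ t, g t * ((imhOp μ w q)^[n + 1] g) t * w t ∂μ)
      / ∫ t, g t ^ 2 * w t ∂μ) :
    (tauInt (fun n => (∫ t, g t * ((imhOp μ w q)^[n] g) t * w t ∂μ) / ∫ t, g t ^ 2 * w t ∂μ)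
        + 1 / 2) / V - 1 / 2
      ≤ tauInt (fun n => (∫ t, g t * ((imhOp μ w q)^[V * n] g) t * w t ∂μ)
        / ∫ t, g t ^ 2 * w t ∂μ) ∧
    tauInt (fun n => (∫ t, g t * ((imhOp μ w q)^[V * n] g) t * w t ∂μ) / ∫ t, g t ^ 2 * w t ∂μ)
      ≤ 1 / 2 + (tauInt (fun n => (∫ t, g t * ((imhOp μ w q)^[n] g) t * w t ∂μ)
        / ∫ t, g t ^ 2 * w t ∂μ) - 1 / 2) / V := by
  have hAi : ∀ ⦃f h : X → ℝ⦄, (Measurable f ∧ ∃ B : ℝ, ∀ t, |f t| ≤ B) →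
      (Measurable h ∧ ∃ B : ℝ, ∀ t, |h t| ≤ B) → Integrable (fun x => f x * h x * w x) μ := by
    intro f h hf hh
    obtain ⟨hfm', Bf, hfb'⟩ := hf
    obtain ⟨hhm', Bh, hhb'⟩ := hh
    exact integrable_mul_mul_weight hw0 hwm hwi hfm' hhm' hfb' hhb'
  have hAc : ∀ ⦃f h : X → ℝ⦄ (l : ℝ), (Measurable f ∧ ∃ B : ℝ, ∀ t, |f t| ≤ B) →
      (Measurable h ∧ ∃ B : ℝ, ∀ t, |h t| ≤ B) →
      (Measurable (fun x => f x + l * h x) ∧ ∃ B : ℝ, ∀ t, |f t + l * h t| ≤ B) := by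
    intro f h l hf hh
    obtain ⟨hfm', Bf, hfb'⟩ := hf
    obtain ⟨hhm', Bh, hhb'⟩ := hh
    refine ⟨hfm'.add (measurable_const.mul hhm'), Bf + |l| * Bh, fun t => ?_⟩
    calc |f t + l * h t| ≤ |f t| + |l * h t| := abs_add_le _ _
      _ ≤ Bf + |l| * Bh := by
          rw [abs_mul]; exact add_le_add (hfb' t) (mul_le_mul_of_nonneg_left (hhb' t) (abs_nonneg _))
  have hAK : ∀ ⦃f : X → ℝ⦄, (Measurable f ∧ ∃ B : ℝ, ∀ t, |f t| ≤ B) →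
      (Measurable (imhOp μ w q f) ∧ ∃ B : ℝ, ∀ t, |imhOp μ w q f t| ≤ B) := by
    intro f hf
    obtain ⟨hfm', Bf, hfb'⟩ := hf
    exact ⟨measurable_imhOp hwm hqm hfm', Bf, imhOp_abs_le hw0 hq0 hqi hq1 hfb'⟩
  have hlin : ∀ ⦃f h : X → ℝ⦄ (l : ℝ), (Measurable f ∧ ∃ B : ℝ, ∀ t, |f t| ≤ B) →
      (Measurable h ∧ ∃ B : ℝ, ∀ t, |h t| ≤ B) →
      ∀ t, imhOp μ w q (fun s => f s + l * h s) t = imhOp μ w q f t + l * imhOp μ w q h t := by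
    intro f h l hf hh t
    obtain ⟨hfm', Bf, hfb'⟩ := hf
    obtain ⟨hhm', Bh, hhb'⟩ := hh
    exact imhOp_add_mul hw0 hwm hq0 hqm hqi hfm' hhm' hfb' hhb' l t
  have hsymm : ∀ ⦃f h : X → ℝ⦄, (Measurable f ∧ ∃ B : ℝ, ∀ t, |f t| ≤ B) →
      (Measurable h ∧ ∃ B : ℝ, ∀ t, |h t| ≤ B) →
      ∫ x, imhOp μ w q f x * h x * w x ∂μ = ∫ x, f x * imhOp μ w q h x * w x ∂μ := by
    intro f h hf hh
    obtain ⟨hfm', Bf, hfb'⟩ := hf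
    obtain ⟨hhm', Bh, hhb'⟩ := hh
    exact integral_imhOp_mul_mul_comm hw0 hwm hwi hq0 hqm hqi hfm' hhm' hfb' hhb'
  have hcontr : ∀ ⦃f : X → ℝ⦄, (Measurable f ∧ ∃ B : ℝ, ∀ t, |f t| ≤ B) →
      ∫ x, imhOp μ w q f x ^ 2 * w x ∂μ ≤ ∫ x, f x ^ 2 * w x ∂μ := by
    intro f hf
    obtain ⟨hfm', Bf, hfb'⟩ := hf
    exact integral_imhOp_sq_le_integral_sq hw0 hwm hwi hq0 hqm hqi hq1 hfm' hfb'
  have hpos : ∀ ⦃f : X → ℝ⦄, (Measurable f ∧ ∃ B : ℝ, ∀ t, |f t| ≤ B) →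
      0 ≤ ∫ x, f x * imhOp μ w q f x * w x ∂μ := by
    intro f hf
    obtain ⟨hfm', Bf, hfb'⟩ := hf
    exact integral_mul_imhOp_mul_nonneg hw0 hwm hwi hq0 hqm hqi hq1 hfm' hfb'
  exact RevOp.thinned_tauInt_pinned_of_pos (μ := μ)
    (A := fun f : X → ℝ => Measurable f ∧ ∃ B : ℝ, ∀ t, |f t| ≤ B) (K := imhOp μ w q) (w := w)
    (fun t => (hw0 t).le) hAi hAc hAK hlin hsymm hcontr hpos ⟨hgm, Bg, hgb⟩ hP hV hs

end General

/-! ## Lattice φ⁴: row 2's flow arm -/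

section Lattice

variable {n : ℕ}

/-- **ROW 2's FLOW ARM DECORRELATES MONOTONICALLY AND CONVEXLY**: every `λ > 0`, real `J`, every
positive measurable model density `q̃` with `∫ q̃ = 1`, every bounded measurable `g`, every lag. -/
theorem phi4Flow_autocov_succ_le_and_convex {lam : ℝ} (hlam : 0 < lam)
    (J : Fin (n + 1) → Fin (n + 1) → ℝ) {q : (Fin (n + 1) → ℝ) → ℝ} (hq0 : ∀ φ, 0 < q φ)
    (hqm : Measurable q) (hqi : Integrable q) (hq1 : ∫ φ, q φ = 1)
    {g : (Fin (n + 1) → ℝ) → ℝ} (hg : BddObs g) (k : ℕ) :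
    ∫ φ, g φ * ((imhOpPhi4 J lam q)^[k + 1] g) φ * gibbsWeight J lam φ
      ≤ ∫ φ, g φ * ((imhOpPhi4 J lam q)^[k] g) φ * gibbsWeight J lam φ ∧
    (∫ φ, g φ * ((imhOpPhi4 J lam q)^[k + 1] g) φ * gibbsWeight J lam φ)
        - ∫ φ, g φ * ((imhOpPhi4 J lam q)^[k + 2] g) φ * gibbsWeight J lam φ
      ≤ (∫ φ, g φ * ((imhOpPhi4 J lam q)^[k] g) φ * gibbsWeight J lam φ)
        - ∫ φ, g φ * ((imhOpPhi4 J lam q)^[k + 1] g) φ * gibbsWeight J lam φ := by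
  have hwi := integrable_gibbsWeight hlam J
  have hw0 : ∀ φ : Fin (n + 1) → ℝ, 0 < gibbsWeight J lam φ := fun φ => gibbsWeight_pos J lam φ
  have hwm : Measurable (gibbsWeight J lam) := (continuous_gibbsWeight J lam).measurable
  obtain ⟨hgm, Bg, hgb⟩ := hg
  rw [imhOpPhi4_eq_imhOp]
  exact imhOp_autocov_succ_le_and_convex (μ := volume) hw0 hwm hwi hq0 hqm hqi hq1 hgm hgb k

/-- **THINNING IS PINNED FOR ROW 2's FLOW ARM**: bounded measurable `g` with `∫ g² e^{−S} > 0` and a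
summable normalised series; recording every `V ≥ 1` flow proposals gives
`(τ + ½)/V − ½ ≤ τ^{(V)} ≤ ½ + (τ − ½)/V`. -/
theorem phi4Flow_thinned_pinned {lam : ℝ} (hlam : 0 < lam)
    (J : Fin (n + 1) → Fin (n + 1) → ℝ) {q : (Fin (n + 1) → ℝ) → ℝ} (hq0 : ∀ φ, 0 < q φ)
    (hqm : Measurable q) (hqi : Integrable q) (hq1 : ∫ φ, q φ = 1)
    {g : (Fin (n + 1) → ℝ) → ℝ} (hg : BddObs g)
    (hP : 0 < ∫ φ, g φ ^ 2 * gibbsWeight J lam φ) {V : ℕ} (hV : 1 ≤ V)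
    (hs : Summable fun k => (∫ φ, g φ * ((imhOpPhi4 J lam q)^[k + 1] g) φ * gibbsWeight J lam φ)
        / ∫ φ, g φ ^ 2 * gibbsWeight J lam φ) :
    (tauInt (fun k => (∫ φ, g φ * ((imhOpPhi4 J lam q)^[k] g) φ * gibbsWeight J lam φ)
        / ∫ φ, g φ ^ 2 * gibbsWeight J lam φ) + 1 / 2) / V - 1 / 2
      ≤ tauInt (fun k => (∫ φ, g φ * ((imhOpPhi4 J lam q)^[V * k] g) φ * gibbsWeight J lam φ)
        / ∫ φ, g φ ^ 2 * gibbsWeight J lam φ) ∧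
    tauInt (fun k => (∫ φ, g φ * ((imhOpPhi4 J lam q)^[V * k] g) φ * gibbsWeight J lam φ)
        / ∫ φ, g φ ^ 2 * gibbsWeight J lam φ)
      ≤ 1 / 2 + (tauInt (fun k => (∫ φ, g φ * ((imhOpPhi4 J lam q)^[k] g) φ * gibbsWeight J lam φ)
        / ∫ φ, g φ ^ 2 * gibbsWeight J lam φ) - 1 / 2) / V := by
  have hwi := integrable_gibbsWeight hlam J
  have hw0 : ∀ φ : Fin (n + 1) → ℝ, 0 < gibbsWeight J lam φ := fun φ => gibbsWeight_pos J lam φ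
  have hwm : Measurable (gibbsWeight J lam) := (continuous_gibbsWeight J lam).measurable
  obtain ⟨hgm, Bg, hgb⟩ := hg
  rw [imhOpPhi4_eq_imhOp] at hs ⊢
  exact imhOp_thinned_pinned (μ := volume) hw0 hwm hwi hq0 hqm hqi hq1 hgm hgb hP hV hs

end Lattice

end Summit.Ventures.LatticeQCDFlow.Exactness
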